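import Literature.Analysis.FluidPDE.TypeIAncientMild
import Literature.Analysis.FluidPDE.NSBoundedMildOseenDuhamel
import Literature.Analysis.FluidPDE.KochTataruPointwise
import Literature.Analysis.UnboundedOperators.HeatKernelBoundedData
import HarnessLib

/-!
# Backward-cone propagation of scale-invariant levels — tools

Helper file for rung R8 `ScrewSymmetricLiouville` of LINE g9-β `filament_selection` on crux
stmt-NavierStokesRegularity-26567 (`NearExtremalTransiencePerFlow`). Symmetry-free estimates for
the localised Kato bootstrap of `ExtremiserTransienceBackwardConePropagation.lean`:

* `oseenDuhamel_eq_add_of_indicator_compl_spaceTime` — splitting the Duhamel term of `u ⊗ u`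
  along a measurable SPACE–TIME partition `S ⊔ Sᶜ` (the tree's
  `oseenDuhamel_eq_add_of_indicator_compl` is the time-independent case);
* `exists_lintegral_far_slice_le`, `exists_norm_oseenDuhamel_far_le` — the Duhamel term of a
  bounded field supported at parabolic-or-larger distance `≥ v (t − τ)` from the evaluation point is
  `O(N² v^{-1/2})` (kernel bound `(τ + |z|²)^{-2}` (3.8), `∫(σ + g² + |z|²)^{-2} dz = π² (σ+g²)^{-1/2}`,
  `(σ + v²σ²)^{-1/2} ≤ (2v)^{-1/2} σ^{-3/4}`, `∫₀³⁵ σ^{-3/4} dσ < 10`);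
* `norm_heatExtension_le_of_small_on_ball` — the caloric extension of data bounded by `η` on a ball
  and by `N` everywhere is `≤ η + N · 2·2^{3/2} √δ / r` at distance `r` inside the ball (first
  moment of the heat kernel, Markov).
[cite: KochNadirashviliSereginSverak2009, §3 (3.8) and §4 p. 8 (arXiv:0709.3599)]
-/

noncomputable section

set_option linter.dupNamespace false

open Set Function Filter MeasureTheory Metric
open scoped Topology ENNReal

namespace Summit.NavierStokesRegularity.NavierStokesRegularity.Theorems.ScrewSymmetricLiouville

open Literature.Analysis Literature.Analysis.FluidPDE Literature.Analysis.UnboundedOperators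

/-! ### A time integral -/

/-- `∫₀ᵇ σ^{-3/4} dσ = 4 b^{1/4}` as a set `∫⁻` (`b > 0`). [folklore] -/
theorem setLIntegral_Ioo_rpow_neg_three_quarters {b : ℝ} (hb : 0 < b) :
    ∫⁻ σ in Ioo 0 b, ENNReal.ofReal (σ ^ (-(3 / 4 : ℝ))) = ENNReal.ofReal (4 * b ^ (1 / 4 : ℝ)) := by
  have hr : (-1 : ℝ) < -(3 / 4 : ℝ) := by norm_num
  have hint : IntegrableOn (fun σ : ℝ => σ ^ (-(3 / 4 : ℝ))) (Ioo 0 b) := by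
    have h := (intervalIntegral.intervalIntegrable_rpow' hr (a := 0) (b := b))
    rw [intervalIntegrable_iff_integrableOn_Ioo_of_le hb.le] at h
    exact h
  rw [← ofReal_integral_eq_lintegral_ofReal hint]
  · congr 1
    rw [← integral_Ioc_eq_integral_Ioo, ← intervalIntegral.integral_of_le hb.le,
      integral_rpow (Or.inl hr)]
    rw [Real.zero_rpow (by norm_num)]
    norm_num
    field_simp
  · refine (ae_restrict_iff' measurableSet_Ioo).2 (Eventually.of_forall fun σ hσ => ?_)
    exact Real.rpow_nonneg hσ.1.le _

/-- `∫_{(s,t)} (t - τ)^{-3/4} dτ = 4 (t - s)^{1/4}` as a set `∫⁻` (reflection `τ ↦ t - τ`). [folklore] -/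
theorem setLIntegral_Ioo_sub_rpow_neg_three_quarters {s t : ℝ} (hst : s < t) :
    ∫⁻ τ in Ioo s t, ENNReal.ofReal ((t - τ) ^ (-(3 / 4 : ℝ))) =
      ENNReal.ofReal (4 * (t - s) ^ (1 / 4 : ℝ)) := by
  have hmp : MeasurePreserving (fun τ : ℝ => t - τ) volume volume :=
    Measure.measurePreserving_sub_left volume t
  have hemb : MeasurableEmbedding (fun τ : ℝ => t - τ) :=
    (MeasurableEquiv.subLeft t).measurableEmbedding
  have h := hmp.setLIntegral_comp_preimage_emb hemb
    (fun σ => ENNReal.ofReal (σ ^ (-(3 / 4 : ℝ)))) (Ioo 0 (t - s))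
  rw [preimage_const_sub_Ioo, sub_zero, sub_sub_cancel] at h
  rw [h, setLIntegral_Ioo_rpow_neg_three_quarters (sub_pos.2 hst)]

/-! ### Splitting the Duhamel term along a space–time partition -/

/-- Measurability of the space–time truncation `(τ, y) ↦ 1_S(τ, y) u(τ, y)` on a slab. [folklore] -/
theorem aestronglyMeasurable_uncurry_indicator_spaceTime
    {u : ℝ → EuclideanSpace ℝ (Fin 3) → EuclideanSpace ℝ (Fin 3)} {a b s T : ℝ}
    (hu : ContinuousOn (uncurry u) (Ioo a b ×ˢ univ)) (has : a ≤ s) (hTb : T ≤ b)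
    {S : Set (ℝ × EuclideanSpace ℝ (Fin 3))} (hS : MeasurableSet S) :
    AEStronglyMeasurable (uncurry fun τ y => S.indicator (uncurry u) (τ, y))
      ((volume : Measure (ℝ × EuclideanSpace ℝ (Fin 3))).restrict (Ioo s T ×ˢ univ)) := by
  have hmeas : AEStronglyMeasurable (uncurry u)
      ((volume : Measure (ℝ × EuclideanSpace ℝ (Fin 3))).restrict (Ioo s T ×ˢ univ)) :=
    (hu.mono (prod_mono (Ioo_subset_Ioo has hTb) subset_rfl)).aestronglyMeasurable
      (measurableSet_Ioo.prod MeasurableSet.univ)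
  have heq : (uncurry fun τ y => S.indicator (uncurry u) (τ, y)) = S.indicator (uncurry u) := by
    funext ⟨τ, y⟩
    rfl
  rw [heq]
  exact hmeas.indicator hS

/-- **Splitting the Duhamel term of `u ⊗ u` along a SPACE–TIME partition.** For a field `u`
bounded and continuous on `(a, b) × ℝ³ ⊇ (s, t) × ℝ³` and a measurable space–time set `S`,
`B^ν_s(u,u)(t)(x) = B^ν_s(1_S u, 1_S u)(t)(x) + B^ν_s(1_{Sᶜ} u, 1_{Sᶜ} u)(t)(x)` (the kernel is
bilinear and pointwise exactly one truncation is `u`). The time-independent case is the tree's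
`oseenDuhamel_eq_add_of_indicator_compl`. [cite: KochNadirashviliSereginSverak2009, proof of Thm 6.2, last paragraph (arXiv p. 13)] -/
theorem oseenDuhamel_eq_add_of_indicator_compl_spaceTime {ν : ℝ} (hν : 0 < ν)
    {u : ℝ → EuclideanSpace ℝ (Fin 3) → EuclideanSpace ℝ (Fin 3)}
    {a b s t L : ℝ} (hu : ContinuousOn (uncurry u) (Ioo a b ×ˢ univ)) (has : a ≤ s) (htb : t ≤ b)
    (hst : s < t) (hL : 0 ≤ L) (hbd : ∀ τ ∈ Ioo s t, ∀ y, ‖u τ y‖ ≤ L)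
    {S : Set (ℝ × EuclideanSpace ℝ (Fin 3))} (hS : MeasurableSet S) (x : EuclideanSpace ℝ (Fin 3)) :
    oseenDuhamel ν s u u t x =
      oseenDuhamel ν s (fun τ y => S.indicator (uncurry u) (τ, y))
          (fun τ y => S.indicator (uncurry u) (τ, y)) t x +
        oseenDuhamel ν s (fun τ y => Sᶜ.indicator (uncurry u) (τ, y))
          (fun τ y => Sᶜ.indicator (uncurry u) (τ, y)) t x := by
  set uo : ℝ → EuclideanSpace ℝ (Fin 3) → EuclideanSpace ℝ (Fin 3) :=
    fun τ y => S.indicator (uncurry u) (τ, y) with huo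
  set uc : ℝ → EuclideanSpace ℝ (Fin 3) → EuclideanSpace ℝ (Fin 3) :=
    fun τ y => Sᶜ.indicator (uncurry u) (τ, y) with huc
  have hum : AEStronglyMeasurable (uncurry u)
      ((volume : Measure (ℝ × EuclideanSpace ℝ (Fin 3))).restrict (Ioo s t ×ˢ univ)) :=
    (hu.mono (prod_mono (Ioo_subset_Ioo has htb) subset_rfl)).aestronglyMeasurable
      (measurableSet_Ioo.prod MeasurableSet.univ)
  have huom := aestronglyMeasurable_uncurry_indicator_spaceTime hu has htb hS (s := s) (T := t)
  have hucm := aestronglyMeasurable_uncurry_indicator_spaceTime hu has htb hS.compl (s := s) (T := t)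
  have hbo : ∀ τ ∈ Ioo s t, ∀ y, ‖uo τ y‖ ≤ L := by
    intro τ hτ y
    simp only [huo]
    by_cases hy : (τ, y) ∈ S
    · rw [indicator_of_mem hy]; exact hbd τ hτ y
    · rw [indicator_of_notMem hy, norm_zero]; exact hL
  have hbc : ∀ τ ∈ Ioo s t, ∀ y, ‖uc τ y‖ ≤ L := by
    intro τ hτ y
    simp only [huc]
    by_cases hy : (τ, y) ∈ Sᶜ
    · rw [indicator_of_mem hy]; exact hbd τ hτ y
    · rw [indicator_of_notMem hy, norm_zero]; exact hL
  have hI := integrable_oseenKernel_duhamel_bounded hν hum hum hL hbd hbd hst le_rfl x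
  have hIo := integrable_oseenKernel_duhamel_bounded hν huom huom hL hbo hbo hst le_rfl x
  have hIc := integrable_oseenKernel_duhamel_bounded hν hucm hucm hL hbc hbc hst le_rfl x
  rw [oseenDuhamel_eq_integral_prod hν hum hum hL hbd hbd hst le_rfl x,
    oseenDuhamel_eq_integral_prod hν huom huom hL hbo hbo hst le_rfl x,
    oseenDuhamel_eq_integral_prod hν hucm hucm hL hbc hbc hst le_rfl x, ← integral_add hIo hIc]
  refine integral_congr_ae (Eventually.of_forall fun p => ?_)
  change oseenKernel (ν * (t - p.1)) (x - p.2) (u p.1 p.2) (u p.1 p.2) =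
    oseenKernel (ν * (t - p.1)) (x - p.2) (S.indicator (uncurry u) (p.1, p.2))
        (S.indicator (uncurry u) (p.1, p.2)) +
      oseenKernel (ν * (t - p.1)) (x - p.2) (Sᶜ.indicator (uncurry u) (p.1, p.2))
        (Sᶜ.indicator (uncurry u) (p.1, p.2))
  by_cases hy : (p.1, p.2) ∈ S
  · have hyc : (p.1, p.2) ∉ Sᶜ := fun h => h hy
    rw [indicator_of_mem hy, indicator_of_notMem hyc, oseenKernel_zero_left, add_zero]
    rfl
  · rw [indicator_of_notMem hy, indicator_of_mem (show (p.1, p.2) ∈ Sᶜ from hy), oseenKernel_zero_left,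
      zero_add]
    rfl

/-! ### The far part of the Duhamel term -/

/-- Pointwise: outside the ball of radius `g` about `x` the kernel weight is dominated by a shifted
integrable weight, `(σ + ‖x−y‖²)^{-2} ≤ 4 (σ + g² + ‖x−y‖²)^{-2}` when `g ≤ ‖x − y‖`. [folklore] -/
theorem rpow_neg_two_le_of_le_norm {σ g : ℝ} (hσ : 0 < σ) (hg : 0 ≤ g)
    {z : EuclideanSpace ℝ (Fin 3)} (hz : g ≤ ‖z‖) :
    (σ + ‖z‖ ^ 2) ^ (-(2 : ℝ)) ≤ 4 * (σ + g ^ 2 + ‖z‖ ^ 2) ^ (-(2 : ℝ)) := by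
  have hg2 : g ^ 2 ≤ ‖z‖ ^ 2 := pow_le_pow_left₀ hg hz 2
  have h1 : σ + g ^ 2 + ‖z‖ ^ 2 ≤ 2 * (σ + ‖z‖ ^ 2) := by nlinarith
  have hpos : 0 < σ + ‖z‖ ^ 2 := by positivity
  have hpos' : 0 < σ + g ^ 2 + ‖z‖ ^ 2 := by positivity
  rw [Real.rpow_neg hpos.le, Real.rpow_neg hpos'.le, Real.rpow_two, Real.rpow_two]
  rw [show (4 : ℝ) * ((σ + g ^ 2 + ‖z‖ ^ 2) ^ 2)⁻¹ = ((σ + g ^ 2 + ‖z‖ ^ 2) ^ 2 / 4)⁻¹ by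
    rw [inv_div]; ring]
  refine inv_anti₀ (by positivity) ?_
  rw [div_le_iff₀ (by norm_num : (0 : ℝ) < 4)]
  nlinarith [mul_self_nonneg (σ + g ^ 2 + ‖z‖ ^ 2), hpos.le]

/-- AM–GM for the parabolic weight with a linear gap: `(σ + (vσ)²)^{-1/2} ≤ (2v)^{-1/2} σ^{-3/4}`
for `σ, v > 0`. [folklore] -/
theorem rpow_neg_half_linear_gap_le {σ v : ℝ} (hσ : 0 < σ) (hv : 0 < v) :
    (σ + (v * σ) ^ 2) ^ (-(1 / 2 : ℝ)) ≤ (2 * v) ^ (-(1 / 2 : ℝ)) * σ ^ (-(3 / 4 : ℝ)) := by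
  -- `2 v σ^{3/2} ≤ σ + v² σ²`
  have hs32 : σ ^ (3 / 2 : ℝ) = σ * Real.sqrt σ := by
    rw [show (3 / 2 : ℝ) = 1 + 1 / 2 by norm_num, Real.rpow_add hσ, Real.rpow_one, Real.sqrt_eq_rpow]
  have hamgm : 2 * v * σ ^ (3 / 2 : ℝ) ≤ σ + (v * σ) ^ 2 := by
    rw [hs32]
    have hsq : Real.sqrt σ * Real.sqrt σ = σ := Real.mul_self_sqrt hσ.le
    nlinarith [mul_self_nonneg (Real.sqrt σ - v * σ), Real.sqrt_nonneg σ, hsq]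
  have hl : 0 < 2 * v * σ ^ (3 / 2 : ℝ) := by positivity
  -- antitonicity of `r ↦ r^{-1/2}`
  have h1 : (σ + (v * σ) ^ 2) ^ (-(1 / 2 : ℝ)) ≤ (2 * v * σ ^ (3 / 2 : ℝ)) ^ (-(1 / 2 : ℝ)) :=
    Real.rpow_le_rpow_of_nonpos hl hamgm (by norm_num)
  refine h1.trans (le_of_eq ?_)
  rw [Real.mul_rpow (by positivity) (Real.rpow_nonneg hσ.le _), ← Real.rpow_mul hσ.le]
  norm_num

/-- **Far slice bound.** There is a universal `C₁ > 0` such that: for `σ > 0`, a gap `g ≥ 0`, a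
bound `N ≥ 0` and any slice fields `a, c : ℝ³ → ℝ³` with `‖a y‖, ‖c y‖ ≤ N` everywhere and
`a y = 0` whenever `‖x − y‖ < g`,
`∫⁻ ‖K(σ, x−y)[a y, c y]‖ dy ≤ C₁ N² (σ + g²)^{-1/2}`. [cite: KochNadirashviliSereginSverak2009, §3 (3.8) (arXiv:0709.3599 p. 6)] -/
theorem exists_lintegral_far_slice_le :
    ∃ C₁ : ℝ, 0 < C₁ ∧ ∀ {σ g N : ℝ}, 0 < σ → 0 ≤ g → 0 ≤ N →
      ∀ {a c : EuclideanSpace ℝ (Fin 3) → EuclideanSpace ℝ (Fin 3)} (x : EuclideanSpace ℝ (Fin 3)),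
        (∀ y, ‖a y‖ ≤ N) → (∀ y, ‖c y‖ ≤ N) → (∀ y, ‖x - y‖ < g → a y = 0) →
        ∫⁻ y, ‖oseenKernel σ (x - y) (a y) (c y)‖ₑ ≤
          ENNReal.ofReal (C₁ * N ^ 2 * (σ + g ^ 2) ^ (-(1 / 2 : ℝ))) := by
  obtain ⟨C₀, hC₀, hK⟩ := exists_norm_oseenKernel_le (E := EuclideanSpace ℝ (Fin 3))
  set I : ℝ := ∫ w : EuclideanSpace ℝ (Fin 3), (1 + ‖w‖ ^ 2) ^ (-(2 : ℝ)) with hI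
  have hd : (Module.finrank ℝ (EuclideanSpace ℝ (Fin 3)) : ℝ) = 3 := by simp
  have he : (Module.finrank ℝ (EuclideanSpace ℝ (Fin 3)) : ℝ) < 2 * 2 := by rw [hd]; norm_num
  have hI0 : 0 < I := integral_one_add_norm_sq_rpow_neg_pos he
  refine ⟨4 * C₀ * I, by positivity, fun {σ g N} hσ hg hN {a c} x ha hc hfar => ?_⟩
  have hexp : -(((Module.finrank ℝ (EuclideanSpace ℝ (Fin 3)) : ℝ) + 1) / 2) = -(2 : ℝ) := by
    rw [hd]; norm_num
  have hσ' : 0 < σ + g ^ 2 := by positivity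
  -- pointwise domination by the shifted weight
  have hdom : ∀ y, ‖oseenKernel σ (x - y) (a y) (c y)‖ ≤
      4 * C₀ * N ^ 2 * (σ + g ^ 2 + ‖x - y‖ ^ 2) ^ (-(2 : ℝ)) := by
    intro y
    by_cases hy : ‖x - y‖ < g
    · rw [hfar y hy, oseenKernel_zero_left, norm_zero]; positivity
    · push Not at hy
      have h1 := hK hσ (x - y) (a y) (c y)
      rw [hexp] at h1
      calc ‖oseenKernel σ (x - y) (a y) (c y)‖
          ≤ C₀ * (σ + ‖x - y‖ ^ 2) ^ (-(2 : ℝ)) * ‖a y‖ * ‖c y‖ := h1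
        _ ≤ C₀ * (4 * (σ + g ^ 2 + ‖x - y‖ ^ 2) ^ (-(2 : ℝ))) * N * N := by
            gcongr
            · exact rpow_neg_two_le_of_le_norm hσ hg hy
            · exact ha y
            · exact hc y
        _ = 4 * C₀ * N ^ 2 * (σ + g ^ 2 + ‖x - y‖ ^ 2) ^ (-(2 : ℝ)) := by ring
  have hscal : (3 : ℝ) / 2 - 2 = -(1 / 2 : ℝ) := by norm_num
  calc ∫⁻ y, ‖oseenKernel σ (x - y) (a y) (c y)‖ₑ
      ≤ ∫⁻ y, ENNReal.ofReal (4 * C₀ * N ^ 2) *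
          ENNReal.ofReal ((σ + g ^ 2 + ‖x - y‖ ^ 2) ^ (-(2 : ℝ))) := by
        refine lintegral_mono fun y => ?_
        rw [← ofReal_norm, ← ENNReal.ofReal_mul (by positivity)]
        exact ENNReal.ofReal_le_ofReal (hdom y)
    _ = ENNReal.ofReal (4 * C₀ * N ^ 2) *
          ∫⁻ y, ENNReal.ofReal ((σ + g ^ 2 + ‖x - y‖ ^ 2) ^ (-(2 : ℝ))) :=
        lintegral_const_mul' _ _ ENNReal.ofReal_ne_top
    _ = ENNReal.ofReal (4 * C₀ * N ^ 2) * ENNReal.ofReal ((σ + g ^ 2) ^ ((3 : ℝ) / 2 - 2) * I) := by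
        rw [lintegral_weight_sub_left, lintegral_add_norm_sq_rpow_neg he hσ', hd]
    _ = ENNReal.ofReal (4 * C₀ * I * N ^ 2 * (σ + g ^ 2) ^ (-(1 / 2 : ℝ))) := by
        rw [← ENNReal.ofReal_mul (by positivity), hscal]
        ring_nf

/-- **The far part of the Duhamel term is small.** With the constant `C₁` of
`exists_lintegral_far_slice_le`: if on `(s, t)` the field `uf` is bounded by `N ≥ 0` and vanishes
at the points `(τ, y)` with `‖x − y‖ < v (t − τ)` (`v > 0`), then
`‖B¹_s(uf, uf)(t)(x)‖ ≤ C₁ N² (2v)^{-1/2} · 4 (t − s)^{1/4}`. [cite: KochNadirashviliSereginSverak2009, §3 (3.8), §4 p. 8 (arXiv:0709.3599)] -/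
theorem exists_norm_oseenDuhamel_far_le :
    ∃ C₁ : ℝ, 0 < C₁ ∧ ∀ {uf : ℝ → EuclideanSpace ℝ (Fin 3) → EuclideanSpace ℝ (Fin 3)} {s t N v : ℝ}
      (x : EuclideanSpace ℝ (Fin 3)), s < t → 0 ≤ N → 0 < v →
      (∀ τ ∈ Ioo s t, ∀ y, ‖uf τ y‖ ≤ N) →
      (∀ τ ∈ Ioo s t, ∀ y, ‖x - y‖ < v * (t - τ) → uf τ y = 0) →
      ‖oseenDuhamel 1 s uf uf t x‖ ≤
        C₁ * N ^ 2 * (2 * v) ^ (-(1 / 2 : ℝ)) * (4 * (t - s) ^ (1 / 4 : ℝ)) := by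
  obtain ⟨C₁, hC₁, hslice⟩ := exists_lintegral_far_slice_le
  refine ⟨C₁, hC₁, fun {uf s t N v} x hst hN hv hbd hfar => ?_⟩
  have hnn : 0 ≤ C₁ * N ^ 2 * (2 * v) ^ (-(1 / 2 : ℝ)) * (4 * (t - s) ^ (1 / 4 : ℝ)) := by
    have : 0 ≤ (t - s) ^ (1 / 4 : ℝ) := Real.rpow_nonneg (sub_pos.2 hst).le _
    positivity
  rw [← ENNReal.ofReal_le_ofReal_iff hnn, ofReal_norm]
  -- slice bounds
  have hsl : ∀ τ ∈ Ioo s t,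
      ∫⁻ y, ‖oseenKernel (1 * (t - τ)) (x - y) (uf τ y) (uf τ y)‖ₑ ≤
        ENNReal.ofReal (C₁ * N ^ 2 * (2 * v) ^ (-(1 / 2 : ℝ))) * ENNReal.ofReal ((t - τ) ^ (-(3 / 4 : ℝ))) := by
    intro τ hτ
    have hσ : 0 < t - τ := sub_pos.2 hτ.2
    rw [one_mul]
    refine (hslice hσ (by positivity : (0 : ℝ) ≤ v * (t - τ)) hN x (hbd τ hτ) (hbd τ hτ)
      (hfar τ hτ)).trans ?_
    rw [← ENNReal.ofReal_mul (by positivity)]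
    refine ENNReal.ofReal_le_ofReal ?_
    have h1 := rpow_neg_half_linear_gap_le hσ hv
    calc C₁ * N ^ 2 * (t - τ + (v * (t - τ)) ^ 2) ^ (-(1 / 2 : ℝ))
        ≤ C₁ * N ^ 2 * ((2 * v) ^ (-(1 / 2 : ℝ)) * (t - τ) ^ (-(3 / 4 : ℝ))) :=
          mul_le_mul_of_nonneg_left h1 (by positivity)
      _ = C₁ * N ^ 2 * (2 * v) ^ (-(1 / 2 : ℝ)) * (t - τ) ^ (-(3 / 4 : ℝ)) := by ring
  calc ‖oseenDuhamel 1 s uf uf t x‖ₑ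
      ≤ ∫⁻ τ in Ioo s t, ‖∫ y, oseenKernel (1 * (t - τ)) (x - y) (uf τ y) (uf τ y)‖ₑ :=
        enorm_integral_le_lintegral_enorm _
    _ ≤ ∫⁻ τ in Ioo s t, ∫⁻ y, ‖oseenKernel (1 * (t - τ)) (x - y) (uf τ y) (uf τ y)‖ₑ :=
        lintegral_mono fun τ => enorm_integral_le_lintegral_enorm _
    _ ≤ ∫⁻ τ in Ioo s t, ENNReal.ofReal (C₁ * N ^ 2 * (2 * v) ^ (-(1 / 2 : ℝ))) *
          ENNReal.ofReal ((t - τ) ^ (-(3 / 4 : ℝ))) :=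
        setLIntegral_mono' measurableSet_Ioo fun τ hτ => hsl τ hτ
    _ = ENNReal.ofReal (C₁ * N ^ 2 * (2 * v) ^ (-(1 / 2 : ℝ))) * ENNReal.ofReal (4 * (t - s) ^ (1 / 4 : ℝ)) := by
        rw [lintegral_const_mul' _ _ ENNReal.ofReal_ne_top, setLIntegral_Ioo_sub_rpow_neg_three_quarters hst]
    _ = ENNReal.ofReal (C₁ * N ^ 2 * (2 * v) ^ (-(1 / 2 : ℝ)) * (4 * (t - s) ^ (1 / 4 : ℝ))) := by
        rw [← ENNReal.ofReal_mul (by positivity)]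

/-! ### The caloric term: local smallness of the data is felt inside the ball -/

/-- **Caloric extension of locally small bounded data.** If `g` is continuous, `‖g‖ ≤ N`
everywhere and `‖g z‖ ≤ η` on the closed ball `‖z − x₀‖ ≤ ρ`, then at a point `x` with
`r := ρ − ‖x − x₀‖ > 0` and heat time `δ > 0`,
`‖e^{δΔ} g (x)‖ ≤ η + N · (2·2^{3/2} δ^{1/2}) / r` (mass one and the first absolute moment of the
heat kernel, Markov's inequality outside the ball of radius `r`). [folklore] -/
theorem norm_heatExtension_le_of_small_on_ball
    {g : EuclideanSpace ℝ (Fin 3) → EuclideanSpace ℝ (Fin 3)} (hg : Continuous g) {N η ρ δ : ℝ}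
    {x₀ x : EuclideanSpace ℝ (Fin 3)} (hN : ∀ z, ‖g z‖ ≤ N) (hη : 0 ≤ η)
    (hsmall : ∀ z, ‖z - x₀‖ ≤ ρ → ‖g z‖ ≤ η) (hx : ‖x - x₀‖ < ρ) (hδ : 0 < δ) :
    ‖heatExtension g δ x‖ ≤
      η + N * (2 * (2 : ℝ) ^ ((Module.finrank ℝ (EuclideanSpace ℝ (Fin 3)) : ℝ) / 2) * δ ^ (1 / 2 : ℝ)) /
        (ρ - ‖x - x₀‖) := by
  set r : ℝ := ρ - ‖x - x₀‖ with hr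
  have hr0 : 0 < r := by rw [hr]; linarith
  have hN0 : 0 ≤ N := (norm_nonneg _).trans (hN 0)
  rw [heatExtension_apply]
  have hint := integrable_heatKernel_smul_of_bound hg hN hδ x
  -- pointwise bound of the integrand
  have hpt : ∀ y : EuclideanSpace ℝ (Fin 3),
      ‖heatKernel δ y • g (x - y)‖ ≤ heatKernel δ y * η + heatKernel δ y * ‖y‖ * (N / r) := by
    intro y
    have hG : 0 ≤ heatKernel δ y := (heatKernel_pos hδ y).le
    rw [norm_smul, Real.norm_of_nonneg hG]
    by_cases hy : ‖y‖ ≤ r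
    · have hin : ‖x - y - x₀‖ ≤ ρ := by
        calc ‖x - y - x₀‖ = ‖(x - x₀) - y‖ := by abel_nf
          _ ≤ ‖x - x₀‖ + ‖y‖ := norm_sub_le _ _
          _ ≤ ρ := by rw [hr] at hy; linarith
      have h1 : heatKernel δ y * ‖g (x - y)‖ ≤ heatKernel δ y * η :=
        mul_le_mul_of_nonneg_left (hsmall _ hin) hG
      have h2 : 0 ≤ heatKernel δ y * ‖y‖ * (N / r) := by positivity
      linarith
    · push Not at hy
      have h1 : ‖g (x - y)‖ ≤ ‖y‖ * (N / r) := by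
        calc ‖g (x - y)‖ ≤ N := hN _
          _ = r * (N / r) := by field_simp
          _ ≤ ‖y‖ * (N / r) := mul_le_mul_of_nonneg_right hy.le (by positivity)
      have h2 : heatKernel δ y * ‖g (x - y)‖ ≤ heatKernel δ y * ‖y‖ * (N / r) := by
        rw [mul_assoc]; exact mul_le_mul_of_nonneg_left h1 hG
      have h3 : 0 ≤ heatKernel δ y * η := by positivity
      linarith
  have hI1 : Integrable fun y : EuclideanSpace ℝ (Fin 3) => heatKernel δ y * η :=
    (integrable_heatKernel_holds hδ).mul_const η
  have hI2 : Integrable fun y : EuclideanSpace ℝ (Fin 3) => heatKernel δ y * ‖y‖ * (N / r) :=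
    (integrable_heatKernel_mul_norm hδ).mul_const (N / r)
  calc ‖∫ y, heatKernel δ y • g (x - y)‖
      ≤ ∫ y, ‖heatKernel δ y • g (x - y)‖ := norm_integral_le_integral_norm _
    _ ≤ ∫ y, (heatKernel δ y * η + heatKernel δ y * ‖y‖ * (N / r)) :=
        integral_mono hint.norm (hI1.add hI2) hpt
    _ = η * (∫ y : EuclideanSpace ℝ (Fin 3), heatKernel δ y) +
          (N / r) * (∫ y : EuclideanSpace ℝ (Fin 3), heatKernel δ y * ‖y‖) := by
        rw [integral_add hI1 hI2, integral_mul_const, integral_mul_const]; ring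
    _ ≤ η * 1 + (N / r) * (2 * (2 : ℝ) ^ ((Module.finrank ℝ (EuclideanSpace ℝ (Fin 3)) : ℝ) / 2) *
          δ ^ (1 / 2 : ℝ)) := by
        rw [integral_heatKernel_eq_one_holds hδ]
        exact add_le_add le_rfl
          (mul_le_mul_of_nonneg_left (integral_heatKernel_mul_norm_le hδ) (by positivity))
    _ = η + N * (2 * (2 : ℝ) ^ ((Module.finrank ℝ (EuclideanSpace ℝ (Fin 3)) : ℝ) / 2) * δ ^ (1 / 2 : ℝ)) / r := by
        rw [mul_one]; ring

end Summit.NavierStokesRegularity.NavierStokesRegularity.Theorems.ScrewSymmetricLiouville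

end
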